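/-
Copyright (c) 2026 the pub-hodgecm-mathlib formalisation cell (harness21).  Prover seat hodgecm-mathlib-LH4-p08 (g2), req620 Track A «(D-RAM) FOUR-FRAME» squad, unit U2H_HSide:
(ρ) `stub_U2H_rowsR_hFamily_unit0`, child (b′) «H-SIDE DEPTH IDENTITY» (dealer LH4-plan (g10) WORD #45 (1); p06 target text 335041993678acc8), brick (b′-5) «ARITHMETIC CORE,
radius-parametrised» of CENSUS `F0/P3c/LH4/LH4-p08/g2/CENSUS-U2H-bprime-p08.v1.LH4p08g2.md` §4 (i) (over LH4-p12 (g0) CENSUS-U2H-bprime.v2 §2).  2026-09-03.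
-/
import Mathlib.Analysis.Complex.Basic
import Mathlib.Algebra.Order.Field.Power
import HarnessLib

/-!
# Crux `H413`, line LH4 «(D-RAM) FOUR-FRAME» road — unit U2H (ii-H), (ρ) child (b′), brick (b′-5): the ARITHMETIC CORE of the H-side depth identity, with the fixed-ball RADIUS
# as a PARAMETER — `Σ_s coef_s·Φ_s = C·4(q^R − q^S)⁺∕(q − 1)` from edge-ball closed forms `Φ_s = ν·2(q^{n+1} − 1)∕(q − 1)` iff `n + 1 = R − S` (and then `(coef₀ + coef₁)·ν = 2C·q^S`)

Cell `hodgecm-mathlib` (D-0151), FLOOR 0, crux item H413 = `stmt-HodgeConjecture-24833`, route of record `HCCMUnconditional`; squad F0∕P3c∕LH4 (req620).  THEOREMS ONLY (no `def`,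
no instance, no notation, no `sorry`, default heartbeats; imports Mathlib + HarnessLib only); lane `--supports stmt-HodgeConjecture-24833 --as helper` (count-neutral).

THE SITUATION (census §1–§3).  Child (b′) of (ρ) is the identity `Σ_{s ∈ Fin 2} coef_s·Φ^st(γ_H, hFamily s) = C·4·max 0 (q^{(n₃+2−d)∕2} − q^{shiftR d t_E})∕(q − 1)` (the `hH` of
★ p855481 `rowOne_of_hSideIdentity_depth`), where by ★ p855077 the left side depends on `γ_H` only through its depth `N = n₃`, by ★ p855495 (b′-1) each `Φ^st(γ_H, 1_{C×U₁})`
unfolds to `ν_H(C×U₁)·(#Fix_{γ₂} + #Fix_{γ₂′})`, and by the (census-gated) dictionary (b′-2)∕(b′-4) both counts are EDGE-BALL counts of some radius `n = n(N, d, t_E)` in the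
`(q+1)`-regular `SL₂(L⁺_v)` tree: `Φ_s = ν·2(q^{n+1} − 1)∕(q − 1)` for both profiles.  This file isolates the pure arithmetic, with `R` (`= (N+2−d)∕2`), `S` (`= shiftR d t_E`) and
the radius `n` as PARAMETERS, so that the (b′) assembly is a rewrite once the dictionary fixes `n`, and so that the census question «which shift?» has an exact Lean meaning:
* §1 `two_mul_zpow_mul_edgeBall_eq` — the `ℚ`-identity `2q^S · 2(q^{n+1} − 1)∕(q − 1) = 4(q^R − q^S)∕(q − 1)` when `n + 1 = R − S`; `max_zero_zpow_sub_zpow` — `(q^R − q^S)⁺ = q^R − q^S` for `S ≤ R`, `1 ≤ q`.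
* §2 FORWARD **`sum_coef_mul_eq_of_edgeBall`** — if `Φ_s = ν·2(q^{n+1} − 1)∕(q − 1)` (`s = 0, 1`), `n + 1 = R − S` and `(coef₀ + coef₁)·ν = 2C·q^S`, then
  `Σ_s coef_s·Φ_s = C·↑(4·max 0 (q^R − q^S)∕(q − 1))` — the target's right-hand side SHAPE (a `ℚ` expression cast to `ℂ`, `max 0`, `zpow`).
* §3 CONVERSE ∕ KILL-SWITCH **`radius_eq_of_sum_coef_mul_eq_two_depths`** — if the identity holds at two consecutive admissible depths, i.e. at `(n, R)` AND at `(n + 1, R + 1)` with the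
  SAME `c = (coef₀ + coef₁)·ν` and `C ≠ 0` (unclipped right-hand sides), then NECESSARILY `n + 1 = R − S` and `c = 2C·q^S`: a constant coefficient vector can absorb no other shift.  So the wild
  `U(Φ₂)` fixed-ball table DECIDES THE TRUTH of the frozen (b′) bytes (census §3), not merely the proof route.
HONEST LABEL.  Count-neutral; no census law is asserted (the radius relation is a HYPOTHESIS here); `HC_CM` is proved only modulo the 7 printed citations (2 remaining named inputs:
hLiu418 = `stmt-HodgeConjecture-24832`, h413 = `stmt-HodgeConjecture-24833`) until rung 0 closes.

## References
* [LabesseLanglands1979] J.-P. Labesse, R. P. Langlands, *L-indistinguishability for SL(2)*, Canad. J. Math. 31 (1979), §2 (2.2) (`δ_m = 2q^m`: the two classes of an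
  elliptic stable class and the ball counts on the tree).
* [Rogawski1990] J. D. Rogawski, *Automorphic Representations of Unitary Groups in Three Variables*, Ann. of Math. Stud. 123 (1990), §4.9 Prop. 4.9.1, Lemma 4.9.3 p. 56
  (the H-side of the unit transfer at a ramified place).
* [Serre1980Trees] J.-P. Serre, *Trees* (1980), Ch. II §1.1 (balls in the `(q+1)`-regular tree: level `j` about an edge has `2q^j` vertices).
-/

set_option autoImplicit false

noncomputable section

namespace Summit.HodgeConjecture.HodgeConjecture.Cruxes.H413.F0P3cDyRamRowOneHSideArithmetic

open Finset

/-! ## §1 The `ℚ`-identities -/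

/-- **`2q^S · 2(q^{n+1} − 1)∕(q − 1) = 4(q^R − q^S)∕(q − 1)`** for `n + 1 = R − S` (`q ≠ 0`): `q^S·q^{n+1} = q^{S + (R − S)} = q^R`. [cite: Serre1980Trees, II §1.1]
[cite: LabesseLanglands1979, §2 (2.2)] -/
theorem two_mul_zpow_mul_edgeBall_eq (q : ℚ) (hq0 : q ≠ 0) (R S : ℤ) (n : ℕ) (hn : (n : ℤ) + 1 = R - S) :
    2 * q ^ S * (2 * (q ^ (n + 1) - 1) / (q - 1)) = 4 * (q ^ R - q ^ S) / (q - 1) := by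
  have hpow : q ^ S * q ^ (n + 1) = q ^ R := by
    rw [← zpow_natCast, ← zpow_add₀ hq0, Nat.cast_succ, hn, add_sub_cancel]
  rw [← mul_div_assoc]
  congr 1
  linear_combination (4 : ℚ) * hpow

/-- **`max 0 (q^R − q^S) = q^R − q^S`** for `1 ≤ q` and `S ≤ R`. [cite: LabesseLanglands1979, §2 (2.2)] -/
theorem max_zero_zpow_sub_zpow (q : ℚ) (hq : 1 ≤ q) {R S : ℤ} (hSR : S ≤ R) : max 0 (q ^ R - q ^ S) = q ^ R - q ^ S :=
  max_eq_right (sub_nonneg.2 (zpow_le_zpow_right₀ hq hSR))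

/-- The edge-ball sum cast to `ℂ`: `↑(2(q^{n+1} − 1)∕(q − 1)) = 2(q^{n+1} − 1)∕(q − 1)` in `ℂ`. [cite: Serre1980Trees, II §1.1] -/
theorem cast_edgeBall (q : ℚ) (n : ℕ) : (((2 * (q ^ (n + 1) - 1) / (q - 1) : ℚ)) : ℂ) = 2 * ((q : ℂ) ^ (n + 1) - 1) / ((q : ℂ) - 1) := by
  push_cast
  ring

/-! ## §2 FORWARD: the H-side depth identity from edge-ball closed forms, radius as a parameter -/

/-- **ARITHMETIC CORE OF (b′), FORWARD.**  Let `q ≥ 2` (a residue cardinal), `R S ∈ ℤ`, `n ∈ ℕ` with the RADIUS RELATION `n + 1 = R − S`, and suppose both H-side profiles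
have the edge-ball value `Φ_s = ν·2(q^{n+1} − 1)∕(q − 1)` and the coefficient vector satisfies `(coef₀ + coef₁)·ν = 2C·q^S`.  Then
`Σ_s coef_s·Φ_s = C·↑(4·max 0 (q^R − q^S)∕(q − 1))` — the right-hand side of child (b′) at `R = (n₃+2−d)∕2`, `S = shiftR d t_E`. [cite: LabesseLanglands1979, §2 (2.2)]
[cite: Rogawski1990, §4.9 Prop. 4.9.1, Lemma 4.9.3 p. 56] -/
theorem sum_coef_mul_eq_of_edgeBall {q : ℕ} (hq : 1 < q) {R S : ℤ} {n : ℕ} (hn : (n : ℤ) + 1 = R - S) (ν C : ℂ) (coef Φ : Fin 2 → ℂ)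
    (hΦ : ∀ s, Φ s = ν * (((2 * ((q : ℚ) ^ (n + 1) - 1) / ((q : ℚ) - 1) : ℚ)) : ℂ)) (hcoef : (coef 0 + coef 1) * ν = 2 * C * (q : ℂ) ^ S) :
    ∑ s, coef s * Φ s = C * (((4 * max 0 ((q : ℚ) ^ R - (q : ℚ) ^ S) / ((q : ℚ) - 1) : ℚ)) : ℂ) := by
  have hq1 : (1 : ℚ) ≤ q := by exact_mod_cast hq.le
  have hq0 : (q : ℚ) ≠ 0 := by exact_mod_cast (Nat.pos_of_ne_zero (by omega)).ne'
  have hSR : S ≤ R := by omega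
  rw [max_zero_zpow_sub_zpow _ hq1 hSR, ← two_mul_zpow_mul_edgeBall_eq _ hq0 R S n hn]
  rw [Fin.sum_univ_two, hΦ 0, hΦ 1, ← mul_assoc, ← mul_assoc, ← add_mul, ← add_mul, hcoef]
  push_cast
  ring

/-! ## §3 CONVERSE ∕ KILL-SWITCH: two consecutive depths force the radius relation and the coefficient sum -/

/-- **ARITHMETIC CORE OF (b′), CONVERSE.**  Let `q ≥ 2`, `C ≠ 0`, and suppose the H-side identity holds with the SAME scalar `c` (= `(coef₀ + coef₁)·ν`) at two consecutive
admissible depths — radius `n` against exponent `R`, and radius `n + 1` against `R + 1` (depth `N ↦ N + 2`):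
`c·2(q^{n+1} − 1)∕(q − 1) = C·4(q^R − q^S)∕(q − 1)` and `c·2(q^{n+2} − 1)∕(q − 1) = C·4(q^{R+1} − q^S)∕(q − 1)`.  Then `c = 2C·q^S` AND `n + 1 = R − S`.  (Subtract `q×` the
first from the second: `2c = 4C·q^S`; substitute back: `q^{S+n+1} = q^R`.)  Hence no constant coefficient vector absorbs a shift other than `S`: the wild fixed-ball table decides
the TRUTH of the frozen (b′) bytes. [cite: LabesseLanglands1979, §2 (2.2)] [cite: Rogawski1990, §4.9 Prop. 4.9.1, Lemma 4.9.3 p. 56] -/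
theorem radius_eq_of_sum_coef_mul_eq_two_depths {q : ℕ} (hq : 1 < q) {R S : ℤ} {n : ℕ} (c C : ℚ) (hC : C ≠ 0)
    (h₁ : c * (2 * ((q : ℚ) ^ (n + 1) - 1) / ((q : ℚ) - 1)) = C * (4 * ((q : ℚ) ^ R - (q : ℚ) ^ S) / ((q : ℚ) - 1)))
    (h₂ : c * (2 * ((q : ℚ) ^ (n + 2) - 1) / ((q : ℚ) - 1)) = C * (4 * ((q : ℚ) ^ (R + 1) - (q : ℚ) ^ S) / ((q : ℚ) - 1))) :
    c = 2 * C * (q : ℚ) ^ S ∧ (n : ℤ) + 1 = R - S := by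
  have hq1 : (1 : ℚ) < q := by exact_mod_cast hq
  have hq0 : (q : ℚ) ≠ 0 := by exact_mod_cast (Nat.pos_of_ne_zero (by omega)).ne'
  have hqm1 : (q : ℚ) - 1 ≠ 0 := sub_ne_zero.2 hq1.ne'
  -- clear denominators
  have e₁ : c * (2 * ((q : ℚ) ^ (n + 1) - 1)) = C * (4 * ((q : ℚ) ^ R - (q : ℚ) ^ S)) := by
    rwa [← mul_div_assoc, ← mul_div_assoc, div_left_inj' hqm1] at h₁
  have e₂ : c * (2 * ((q : ℚ) ^ (n + 2) - 1)) = C * (4 * ((q : ℚ) ^ (R + 1) - (q : ℚ) ^ S)) := by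
    rwa [← mul_div_assoc, ← mul_div_assoc, div_left_inj' hqm1] at h₂
  have hR1 : (q : ℚ) ^ (R + 1) = (q : ℚ) ^ R * q := by rw [zpow_add_one₀ hq0]
  have hn2 : (q : ℚ) ^ (n + 2) = (q : ℚ) ^ (n + 1) * q := by rw [pow_succ]
  -- `e₂ − q·e₁`: `2c(q − 1) = 4C q^S (q − 1)`
  have hc : c = 2 * C * (q : ℚ) ^ S := by
    have key : c * 2 * ((q : ℚ) - 1) = C * 4 * (q : ℚ) ^ S * ((q : ℚ) - 1) := by
      have := congrArg₂ (· - (q : ℚ) * ·) e₂ e₁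
      rw [hn2, hR1] at this
      linear_combination this
    have := mul_right_cancel₀ hqm1 key
    linear_combination this / 2
  refine ⟨hc, ?_⟩
  -- substitute: `q^S · q^{n+1} = q^R`
  have hpow : (q : ℚ) ^ S * (q : ℚ) ^ (n + 1) = (q : ℚ) ^ R := by
    have h4C : (4 : ℚ) * C ≠ 0 := mul_ne_zero (by norm_num) hC
    rw [hc] at e₁
    have : 4 * C * ((q : ℚ) ^ S * (q : ℚ) ^ (n + 1) - (q : ℚ) ^ R) = 0 := by linear_combination e₁
    rcases mul_eq_zero.1 this with h | h
    · exact absurd h h4C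
    · exact sub_eq_zero.1 h
  rw [← zpow_natCast, ← zpow_add₀ hq0] at hpow
  have hinj := zpow_right_injective₀ (by exact_mod_cast Nat.pos_of_ne_zero (by omega) : (0 : ℚ) < q) hq1.ne' hpow
  push_cast at hinj
  omega

end Summit.HodgeConjecture.HodgeConjecture.Cruxes.H413.F0P3cDyRamRowOneHSideArithmetic

end
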